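import Mathlib.RingTheory.Finiteness.Basic
import Mathlib.RingTheory.Noetherian.Basic
import Mathlib.LinearAlgebra.Quotient.Basic
import Mathlib.RingTheory.Ideal.Maps
import Mathlib.Algebra.Module.Submodule.Pointwise
import HarnessLib

/-!
# The kernel of reduction modulo an ideal of an embedding `A ≤ B` is a subquotient of `(B/A)ⁿ` — so
# the `χ`-PROJECTION of the Coleman embedding has a kernel finitely generated over the coefficients
# (the `Tor₁(B/A, Λ/I)`-term of de Shalit III.1.8–1.10, made elementary)

Cell `bsd-print-cf2`, width seat `bsd-line-cf2c-w7` g0, route C `PrintCf2RubinValueTwo`, crux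
`TwoVariableMainConjAtSplitTwo` (stmt-BirchSwinnertonDyer-23720, S3a); fifth file of the brick §4(c)
lane. WHY: de Shalit's Coleman embedding `i : 𝒰 ⊗̂ 𝐃 ≅ Λ₁ ⊆ Λ = 𝐃[H'][[Γ]]` (I.3.7, III.1.3) is injective
with cokernel `Λ/Λ₁ ≅ 𝐃(1)[𝒢/𝒵]`, finitely generated over `𝐃`; the main conjecture is stated per
character `χ` of `H'` on the `χ`-QUOTIENTS `M_χ = M/I_χM` (III.1.8 (14): "the largest quotient of `M` on
which `H'` acts through `χ`"; at `p = 2 ∣ #H'` the isotypic decomposition is not available), and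
`𝒰_χ → Λ_χ = 𝐃'⟦Γ⟧` is no longer injective: its kernel `(Λ₁ ∩ I_χΛ)/I_χΛ₁` is the image of
`Tor₁^Λ(Λ/Λ₁, Λ/I_χ)`. The seat's `charIdeal_quotient_eq_span_of_colemanMap(_dvr)` (p682272) allows a
PSEUDO-NULL kernel, and `isPseudoNull_dvr_of_moduleFinite` makes "finitely generated over `𝐃`" enough;
this file supplies that finiteness, ring-generically and without homological algebra. THEOREMS ONLY
(no `def`, no named fact, no `sorry`); Mathlib-only imports; `--supports` the crux as a helper. BSD is
not proved by any of this; no summit statement is proved here.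

* `exists_surjective_onto_ker_reduction`: for a commutative ring `Λ`, a submodule `A ≤ B` and
  `I = (s₁, …, sₙ)`, there are a submodule `P̄ ≤ (B/A)ⁿ` and a SURJECTIVE `Λ`-linear map
  `P̄ ↠ ker(A/IA → B/IB)` (`P = {b ∈ Bⁿ : Σ sⱼbⱼ ∈ A}`, `P̄` its image in `(B/A)ⁿ`, `b ↦ Σ sⱼbⱼ mod IA`;
  well defined because `Σ sⱼaⱼ ∈ IA` for `a ∈ Aⁿ`; onto because `IB = {Σ sⱼbⱼ}`).
* `moduleFinite_ker_reduction`: hence, for an `𝒪`-algebra `Λ` acting compatibly (`IsScalarTower`),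
  `B/A` finitely generated over the Noetherian ring `𝒪` ⟹ `ker(A/IA → B/IB)` finitely generated over `𝒪`.

References: E. de Shalit (1987), III §1.8 (14), Lemma 1.10 (store p0094–p0096) [deShalit1987];
N. Bourbaki, *Algèbre* X §4 (`Tor` and reduction) [BourbakiAC5to7]; the seat's files p681444, p682272,
p683239, p683704 and memo `Cruxes/TwoVariableMainConjAtSplitTwo/BRICK-C-AT-TWO.md`.
-/

noncomputable section

set_option linter.dupNamespace false

open scoped Classical

namespace Summit.BirchSwinnertonDyer.BirchSwinnertonDyer.Theorems.PrintCf2.SemilocalColeman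

universe u v w

section ReductionKernel

variable {Λ : Type u} [CommRing Λ] {B : Type v} [AddCommGroup B] [Module Λ B]

/-- Reduction modulo `I` of the inclusion `A ≤ B`: `A/IA → B/IB`. [folklore] -/
theorem smul_top_le_comap_subtype (I : Ideal Λ) (A : Submodule Λ B) :
    (I • ⊤ : Submodule Λ A) ≤ (I • ⊤ : Submodule Λ B).comap A.subtype := by
  rw [Submodule.smul_le]
  intro r hr a _
  rw [Submodule.mem_comap, Submodule.subtype_apply, Submodule.coe_smul]
  exact Submodule.smul_mem_smul hr Submodule.mem_top

/-- **The kernel of `A/IA → B/IB` is a subquotient of `(B/A)ⁿ`** for an ideal `I = (s₁, …, sₙ)` and a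
submodule `A ≤ B` over any commutative ring: there are a submodule `P̄ ≤ (B/A)ⁿ` and a surjective
linear map `P̄ ↠ ker(A/IA → B/IB)`. (`P = {b ∈ Bⁿ : Σ sⱼbⱼ ∈ A}`, `P̄` its image in `(B/A)ⁿ`,
`b ↦ Σ sⱼbⱼ mod IA`; this is the image of `Tor₁^Λ(B/A, Λ/I)` in `A/IA`.) Use: with `B = 𝐃[H']⟦Γ⟧ ⊇
A = i(𝒰 ⊗̂ 𝐃)` (the Coleman embedding, de Shalit III.1.3) and `I = I_χ`, the kernel of the
`χ`-projection `𝒰_χ → Λ_χ` is finitely generated over `𝐃` as soon as `B/A ≅ 𝐃(1)[𝒢/𝒵]` is — hence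
pseudo-null over `𝐃⟦T₁,T₂⟧` (`isPseudoNull_dvr_of_moduleFinite`), the `hker` of
`charIdeal_quotient_eq_span_of_colemanMap_dvr`. [cite: deShalit1987, III §1.8 (14) and Lemma 1.10 (store p0094–p0096)] -/
theorem exists_surjective_onto_ker_reduction {n : ℕ} (s : Fin n → Λ) (A : Submodule Λ B) :
    ∃ (P : Submodule Λ (Fin n → B ⧸ A))
      (g : P →ₗ[Λ] LinearMap.ker (Submodule.mapQ (Ideal.span (Set.range s) • ⊤ : Submodule Λ A)
        (Ideal.span (Set.range s) • ⊤ : Submodule Λ B) A.subtype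
        (smul_top_le_comap_subtype _ A))),
      Function.Surjective g := by
  set I : Ideal Λ := Ideal.span (Set.range s) with hIdef
  set red := Submodule.mapQ (I • ⊤ : Submodule Λ A) (I • ⊤ : Submodule Λ B) A.subtype
    (smul_top_le_comap_subtype I A) with hred
  -- `ψ : Bⁿ → B`, `(bⱼ) ↦ Σ sⱼ • bⱼ`, with image `IB`
  let ψ : (Fin n → B) →ₗ[Λ] B := ∑ j, s j • LinearMap.proj j
  have hψ : ∀ b : Fin n → B, ψ b = ∑ j, s j • b j := fun b => by
    simp [ψ, LinearMap.sum_apply]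
  have hψmem : ∀ b : Fin n → B, ψ b ∈ (I • ⊤ : Submodule Λ B) := fun b => by
    rw [hψ]
    exact Submodule.sum_mem _ fun j _ =>
      Submodule.smul_mem_smul (Ideal.subset_span ⟨j, rfl⟩) Submodule.mem_top
  have hψsurj : ∀ x ∈ (I • ⊤ : Submodule Λ B), ∃ b : Fin n → B, ψ b = x := by
    intro x hx
    refine Submodule.smul_induction_on (p := fun x => ∃ b : Fin n → B, ψ b = x) hx ?_ ?_
    · intro r hr m _
      obtain ⟨c, hc⟩ := (Ideal.mem_span_range_iff_exists_fun (R := Λ)).mp hr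
      refine ⟨fun j => c j • m, ?_⟩
      rw [hψ, ← hc, Finset.sum_smul]
      exact Finset.sum_congr rfl fun j _ => by rw [smul_smul, mul_comm]
    · rintro x y ⟨b, rfl⟩ ⟨b', rfl⟩
      exact ⟨b + b', map_add ψ b b'⟩
  -- `P = ψ⁻¹(A)` and `g̃ : P → ker`, `p ↦ Σ sⱼpⱼ mod IA`
  let P : Submodule Λ (Fin n → B) := A.comap ψ
  have hPmem : ∀ q : P, ψ (q : Fin n → B) ∈ A := fun q => q.2
  let toA : P →ₗ[Λ] A := (ψ.domRestrict P).codRestrict A hPmem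
  have htoA : ∀ q : P, ((toA q : A) : B) = ψ (q : Fin n → B) := fun q => rfl
  have hker_mem : ∀ q : P, (I • ⊤ : Submodule Λ A).mkQ (toA q) ∈ LinearMap.ker red := by
    intro q
    rw [LinearMap.mem_ker, hred, Submodule.mkQ_apply, Submodule.mapQ_apply, Submodule.subtype_apply,
      htoA, Submodule.Quotient.mk_eq_zero]
    exact hψmem _
  let gt : P →ₗ[Λ] LinearMap.ker red :=
    ((I • ⊤ : Submodule Λ A).mkQ ∘ₗ toA).codRestrict (LinearMap.ker red) hker_mem
  have hgt : ∀ q : P, ((gt q : LinearMap.ker red) : A ⧸ (I • ⊤ : Submodule Λ A)) =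
      (I • ⊤ : Submodule Λ A).mkQ (toA q) := fun q => rfl
  -- `g̃` is onto the kernel
  have hgt_surj : Function.Surjective gt := by
    rintro ⟨k, hk⟩
    obtain ⟨a, rfl⟩ := Submodule.mkQ_surjective (I • ⊤ : Submodule Λ A) k
    have ha : (a : B) ∈ (I • ⊤ : Submodule Λ B) := by
      rw [LinearMap.mem_ker, hred, Submodule.mkQ_apply, Submodule.mapQ_apply,
        Submodule.Quotient.mk_eq_zero] at hk
      exact hk
    obtain ⟨b, hb⟩ := hψsurj _ ha
    have hbP : b ∈ P := by
      change ψ b ∈ A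
      rw [hb]; exact a.2
    refine ⟨⟨b, hbP⟩, Subtype.ext ?_⟩
    rw [hgt]
    simp only [Submodule.mkQ_apply]
    congr 1
    exact Subtype.ext hb
  -- `g̃` kills `P ∩ Aⁿ`, the kernel of `P → (B/A)ⁿ`
  let πn : (Fin n → B) →ₗ[Λ] (Fin n → B ⧸ A) := A.mkQ.compLeft (Fin n)
  let πP : P →ₗ[Λ] (Fin n → B ⧸ A) := πn.domRestrict P
  have hle : LinearMap.ker πP ≤ LinearMap.ker gt := by
    intro q hq
    rw [LinearMap.mem_ker] at hq ⊢
    have hqA : ∀ j, (q : Fin n → B) j ∈ A := fun j => by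
      have h : A.mkQ ((q : Fin n → B) j) = 0 := congrFun hq j
      rwa [Submodule.mkQ_apply, Submodule.Quotient.mk_eq_zero] at h
    apply Subtype.ext
    rw [hgt, Submodule.mkQ_apply, ZeroMemClass.coe_zero, Submodule.Quotient.mk_eq_zero]
    have heq : toA q = ∑ j, s j • (⟨(q : Fin n → B) j, hqA j⟩ : A) := by
      apply Subtype.ext
      rw [htoA, hψ, Submodule.coe_sum]
      rfl
    rw [heq]
    exact Submodule.sum_mem _ fun j _ =>
      Submodule.smul_mem_smul (Ideal.subset_span ⟨j, rfl⟩) Submodule.mem_top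
  -- descend `g̃` to `P̄ = image of P in (B/A)ⁿ`
  refine ⟨LinearMap.range πP,
    ((LinearMap.ker πP).liftQ gt hle) ∘ₗ πP.quotKerEquivRange.symm.toLinearMap, ?_⟩
  rw [LinearMap.coe_comp]
  refine Function.Surjective.comp ?_ πP.quotKerEquivRange.symm.surjective
  intro k
  obtain ⟨q, rfl⟩ := hgt_surj k
  exact ⟨Submodule.Quotient.mk q, by rw [Submodule.liftQ_apply]⟩


/-- **Finiteness over the coefficients of the kernel of reduction.** If `Λ` is an `𝒪`-algebra
(`𝒪` Noetherian) acting compatibly on `B`, and `B/A` is finitely generated OVER `𝒪`, then so is the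
kernel of `A/IA → B/IB` for every finitely generated ideal `I = (s₁, …, sₙ)` of `Λ` — the input of
`isPseudoNull_of_moduleFinite_coeff` / `isPseudoNull_dvr_of_moduleFinite` (pseudo-nullity of the
kernel of the `χ`-projected Coleman map, `charIdeal_quotient_eq_span_of_colemanMap_dvr`'s `hker`).
[cite: deShalit1987, III §1.8 (14) and Lemma 1.10 (store p0094–p0096)] -/
theorem moduleFinite_ker_reduction {𝒪 : Type w} [CommRing 𝒪] [IsNoetherianRing 𝒪] [Algebra 𝒪 Λ]
    [Module 𝒪 B] [IsScalarTower 𝒪 Λ B] {n : ℕ} (s : Fin n → Λ) (A : Submodule Λ B)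
    [Module.Finite 𝒪 (B ⧸ A)] :
    Module.Finite 𝒪 (LinearMap.ker (Submodule.mapQ (Ideal.span (Set.range s) • ⊤ : Submodule Λ A)
        (Ideal.span (Set.range s) • ⊤ : Submodule Λ B) A.subtype
        (smul_top_le_comap_subtype _ A))) := by
  obtain ⟨P, g, hg⟩ := exists_surjective_onto_ker_reduction s A
  haveI : IsNoetherian 𝒪 (Fin n → B ⧸ A) := isNoetherian_of_isNoetherianRing_of_finite 𝒪 _
  haveI : IsNoetherian 𝒪 P :=
    isNoetherian_of_injective (P.subtype.restrictScalars 𝒪) (Submodule.injective_subtype P)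
  exact Module.Finite.of_surjective (g.restrictScalars 𝒪) hg

end ReductionKernel

end Summit.BirchSwinnertonDyer.BirchSwinnertonDyer.Theorems.PrintCf2.SemilocalColeman

end
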